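import Summits.Ventures.YMGap.RobustBall.StringTensionOnBallW
import Summits.Ventures.YMGap.RobustBall.AreaLawRowsSU3PV2T
import HarnessLib

/-!
# Venture YMGap, track Y2 ROBUST-BALL — `SU(3)` STRING TENSION ON THE BALL, HYPOTHESIS-FREE to `β_W = 29/50`: the infinite-volume reading of the
# twisted-constant (PV2T) area-law rows (`AreaLawRowsSU3PV2T`), `d = 4`, tiers 1 and 2

HONEST FRAMING.  Venture file of the cell `pub-ymgap` (QuantumFields programme), seat engine-2 (g11); 0 compute.  Strong-coupling LATTICE
statements only; nothing about the continuum, a spectral mass gap, weak coupling, or Clay.  rb-p2's `suFundStringTension_ge_onBall` /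
`suFundStringTension_ge_onBallW` (tree: every `N`; input an `AreaLawOnBall(W) N 4 β … ` row BY NAME) turn each TORUS area-law row into a statement about
every INFINITE-VOLUME LIMIT STATE `μ` of every eventually-member family `𝓦` of the ball (`perturbedLimitPoints β 𝓦`, non-empty by compactness): ONE pair
`(C, c)`, `c > 0`, with the `ℤ⁴` area law `HasAreaLawWith μ χ₃ C c` (`χ₃ = (1/3) Re tr`) and `c ≤ suFundStringTension 3 μ` WHENEVER the string tension of
`μ` exists (existence NOT asserted: a generic member is not reflection positive).  This file records the `SU(3)` HYPOTHESIS-FREE instances (class K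
outright) on this seat's PV2T pair-door rows `RobustBallPV.su3_pv2tRow4_*` / `su3_pv2tRowW4_*` (twisted one-link Poincaré constant) from `β_W = 1/4` on:
* TIER 1 (`ClusterDomainFR (2ε) ε r`, every `r`, every `mv ≥ 1`), `(β_W; ε₀, ε₁)`: (1/4; .710, .355) (3/10; .602, .301) (2/5; .394, .197) (12/25; .234, .117) (1/2; .194, .097) (11/20; .096, .048) (14/25; .078, .039) (29/50; .038, .019);
* TIER 2 (`ClusterDomain (log 6/5) (2ε) ε`, every `mv ≥ 1`): (2/5; .362, .181) (9/20; .258, .129) (1/2; .158, .079) (11/20; .058, .029) (14/25; .038, .019).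
WHAT MOVES: the hypothesis-free `SU(3)` string-tension-on-the-ball instances of `StringTensionOnBallSU3PV2` (engine-2 g10, 1ed95d0d59df) reached `β_W = 12/25`
(tier 1) and `9/20` (tier 2); here they reach `29/50` (tier 1) and `14/25` (tier 2), with larger balls at every common coupling (`1/4`: `(0.710, 0.355)` vs
`(0.596, 0.298)`).  The CONDITIONAL instances (H1 ∧ H2, to `11/20` / `3/4`) are untouched.
-/

noncomputable section

open MeasureTheory Filter Topology
open Literature.MathematicalPhysics.QuantumLattice
open Literature.MathematicalPhysics.QuantumFieldTheory hiding ZdEdge Site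
open Literature.Barriers.QuantumFields (suFundStringTension)
open Summit.Ventures.YMGap.RobustBall

namespace Summit.Ventures.YMGap.RobustBallPV

/-! ### Tier 1 (`ClusterDomainFR (2ε) ε r`) -/

/-- **`SU(3)`, `d = 4`, `β_W = 1/4`, ball `(ε₀, ε₁) = (.710, .355)`, HYPOTHESIS-FREE: string tension on the ball** — one `c > 0` such that
every infinite-volume limit state `μ` of every eventually-member family satisfies `HasAreaLawWith μ χ₃ C c` and, whenever its string tension exists,
`c ≤ suFundStringTension 3 μ`.  Input: `su3_pv2tRow4_1_4`. [folklore] -/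
theorem su3_stringTension_onBall_pv2t_1_4 (r : ℕ) {mv : ℕ} (hmv : 1 ≤ mv) :
    ∃ C c : ℝ, 0 < c ∧ ∀ 𝓦 : PerturbationFamily 4 3,
      (∀ᶠ L : ℕ in atTop, 𝓦 L ∈ ClusterDomainFR (2 * (71 / 200)) (71 / 200) r ∧ IsSlabLocal mv (𝓦 L)) →
        ∀ μ ∈ perturbedLimitPoints ((1 / 4 : ℝ) / 3) 𝓦,
          HasAreaLawWith μ (fun g => normalisedCharacter 3 (fundamentalRep (Fin 3) g)) C c ∧
          ((∃ σ : ℝ, HasStringTension μ (fun g => normalisedCharacter 3 (fundamentalRep (Fin 3) g)) σ) →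
            c ≤ suFundStringTension 3 μ) :=
  suFundStringTension_ge_onBall (su3_pv2tRow4_1_4 r hmv)

/-- **`SU(3)`, `d = 4`, `β_W = 3/10`, ball `(ε₀, ε₁) = (.602, .301)`, HYPOTHESIS-FREE: string tension on the ball** — one `c > 0` such that
every infinite-volume limit state `μ` of every eventually-member family satisfies `HasAreaLawWith μ χ₃ C c` and, whenever its string tension exists,
`c ≤ suFundStringTension 3 μ`.  Input: `su3_pv2tRow4_3_10`. [folklore] -/
theorem su3_stringTension_onBall_pv2t_3_10 (r : ℕ) {mv : ℕ} (hmv : 1 ≤ mv) :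
    ∃ C c : ℝ, 0 < c ∧ ∀ 𝓦 : PerturbationFamily 4 3,
      (∀ᶠ L : ℕ in atTop, 𝓦 L ∈ ClusterDomainFR (2 * (301 / 1000)) (301 / 1000) r ∧ IsSlabLocal mv (𝓦 L)) →
        ∀ μ ∈ perturbedLimitPoints ((3 / 10 : ℝ) / 3) 𝓦,
          HasAreaLawWith μ (fun g => normalisedCharacter 3 (fundamentalRep (Fin 3) g)) C c ∧
          ((∃ σ : ℝ, HasStringTension μ (fun g => normalisedCharacter 3 (fundamentalRep (Fin 3) g)) σ) →
            c ≤ suFundStringTension 3 μ) :=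
  suFundStringTension_ge_onBall (su3_pv2tRow4_3_10 r hmv)

/-- **`SU(3)`, `d = 4`, `β_W = 2/5`, ball `(ε₀, ε₁) = (.394, .197)`, HYPOTHESIS-FREE: string tension on the ball** — one `c > 0` such that
every infinite-volume limit state `μ` of every eventually-member family satisfies `HasAreaLawWith μ χ₃ C c` and, whenever its string tension exists,
`c ≤ suFundStringTension 3 μ`.  Input: `su3_pv2tRow4_2_5`. [folklore] -/
theorem su3_stringTension_onBall_pv2t_2_5 (r : ℕ) {mv : ℕ} (hmv : 1 ≤ mv) :
    ∃ C c : ℝ, 0 < c ∧ ∀ 𝓦 : PerturbationFamily 4 3,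
      (∀ᶠ L : ℕ in atTop, 𝓦 L ∈ ClusterDomainFR (2 * (197 / 1000)) (197 / 1000) r ∧ IsSlabLocal mv (𝓦 L)) →
        ∀ μ ∈ perturbedLimitPoints ((2 / 5 : ℝ) / 3) 𝓦,
          HasAreaLawWith μ (fun g => normalisedCharacter 3 (fundamentalRep (Fin 3) g)) C c ∧
          ((∃ σ : ℝ, HasStringTension μ (fun g => normalisedCharacter 3 (fundamentalRep (Fin 3) g)) σ) →
            c ≤ suFundStringTension 3 μ) :=
  suFundStringTension_ge_onBall (su3_pv2tRow4_2_5 r hmv)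

/-- **`SU(3)`, `d = 4`, `β_W = 12/25`, ball `(ε₀, ε₁) = (.234, .117)`, HYPOTHESIS-FREE: string tension on the ball** — one `c > 0` such that
every infinite-volume limit state `μ` of every eventually-member family satisfies `HasAreaLawWith μ χ₃ C c` and, whenever its string tension exists,
`c ≤ suFundStringTension 3 μ`.  Input: `su3_pv2tRow4_12_25`. [folklore] -/
theorem su3_stringTension_onBall_pv2t_12_25 (r : ℕ) {mv : ℕ} (hmv : 1 ≤ mv) :
    ∃ C c : ℝ, 0 < c ∧ ∀ 𝓦 : PerturbationFamily 4 3,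
      (∀ᶠ L : ℕ in atTop, 𝓦 L ∈ ClusterDomainFR (2 * (117 / 1000)) (117 / 1000) r ∧ IsSlabLocal mv (𝓦 L)) →
        ∀ μ ∈ perturbedLimitPoints ((12 / 25 : ℝ) / 3) 𝓦,
          HasAreaLawWith μ (fun g => normalisedCharacter 3 (fundamentalRep (Fin 3) g)) C c ∧
          ((∃ σ : ℝ, HasStringTension μ (fun g => normalisedCharacter 3 (fundamentalRep (Fin 3) g)) σ) →
            c ≤ suFundStringTension 3 μ) :=
  suFundStringTension_ge_onBall (su3_pv2tRow4_12_25 r hmv)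

/-- **`SU(3)`, `d = 4`, `β_W = 1/2`, ball `(ε₀, ε₁) = (.194, .097)`, HYPOTHESIS-FREE: string tension on the ball** — one `c > 0` such that
every infinite-volume limit state `μ` of every eventually-member family satisfies `HasAreaLawWith μ χ₃ C c` and, whenever its string tension exists,
`c ≤ suFundStringTension 3 μ`.  Input: `su3_pv2tRow4_1_2`. [folklore] -/
theorem su3_stringTension_onBall_pv2t_1_2 (r : ℕ) {mv : ℕ} (hmv : 1 ≤ mv) :
    ∃ C c : ℝ, 0 < c ∧ ∀ 𝓦 : PerturbationFamily 4 3,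
      (∀ᶠ L : ℕ in atTop, 𝓦 L ∈ ClusterDomainFR (2 * (97 / 1000)) (97 / 1000) r ∧ IsSlabLocal mv (𝓦 L)) →
        ∀ μ ∈ perturbedLimitPoints ((1 / 2 : ℝ) / 3) 𝓦,
          HasAreaLawWith μ (fun g => normalisedCharacter 3 (fundamentalRep (Fin 3) g)) C c ∧
          ((∃ σ : ℝ, HasStringTension μ (fun g => normalisedCharacter 3 (fundamentalRep (Fin 3) g)) σ) →
            c ≤ suFundStringTension 3 μ) :=
  suFundStringTension_ge_onBall (su3_pv2tRow4_1_2 r hmv)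

/-- **`SU(3)`, `d = 4`, `β_W = 11/20`, ball `(ε₀, ε₁) = (.096, .048)`, HYPOTHESIS-FREE: string tension on the ball** — one `c > 0` such that
every infinite-volume limit state `μ` of every eventually-member family satisfies `HasAreaLawWith μ χ₃ C c` and, whenever its string tension exists,
`c ≤ suFundStringTension 3 μ`.  Input: `su3_pv2tRow4_11_20`. [folklore] -/
theorem su3_stringTension_onBall_pv2t_11_20 (r : ℕ) {mv : ℕ} (hmv : 1 ≤ mv) :
    ∃ C c : ℝ, 0 < c ∧ ∀ 𝓦 : PerturbationFamily 4 3,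
      (∀ᶠ L : ℕ in atTop, 𝓦 L ∈ ClusterDomainFR (2 * (6 / 125)) (6 / 125) r ∧ IsSlabLocal mv (𝓦 L)) →
        ∀ μ ∈ perturbedLimitPoints ((11 / 20 : ℝ) / 3) 𝓦,
          HasAreaLawWith μ (fun g => normalisedCharacter 3 (fundamentalRep (Fin 3) g)) C c ∧
          ((∃ σ : ℝ, HasStringTension μ (fun g => normalisedCharacter 3 (fundamentalRep (Fin 3) g)) σ) →
            c ≤ suFundStringTension 3 μ) :=
  suFundStringTension_ge_onBall (su3_pv2tRow4_11_20 r hmv)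

/-- **`SU(3)`, `d = 4`, `β_W = 14/25`, ball `(ε₀, ε₁) = (.078, .039)`, HYPOTHESIS-FREE: string tension on the ball** — one `c > 0` such that
every infinite-volume limit state `μ` of every eventually-member family satisfies `HasAreaLawWith μ χ₃ C c` and, whenever its string tension exists,
`c ≤ suFundStringTension 3 μ`.  Input: `su3_pv2tRow4_14_25`. [folklore] -/
theorem su3_stringTension_onBall_pv2t_14_25 (r : ℕ) {mv : ℕ} (hmv : 1 ≤ mv) :
    ∃ C c : ℝ, 0 < c ∧ ∀ 𝓦 : PerturbationFamily 4 3,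
      (∀ᶠ L : ℕ in atTop, 𝓦 L ∈ ClusterDomainFR (2 * (39 / 1000)) (39 / 1000) r ∧ IsSlabLocal mv (𝓦 L)) →
        ∀ μ ∈ perturbedLimitPoints ((14 / 25 : ℝ) / 3) 𝓦,
          HasAreaLawWith μ (fun g => normalisedCharacter 3 (fundamentalRep (Fin 3) g)) C c ∧
          ((∃ σ : ℝ, HasStringTension μ (fun g => normalisedCharacter 3 (fundamentalRep (Fin 3) g)) σ) →
            c ≤ suFundStringTension 3 μ) :=
  suFundStringTension_ge_onBall (su3_pv2tRow4_14_25 r hmv)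

/-- **`SU(3)`, `d = 4`, `β_W = 29/50`, ball `(ε₀, ε₁) = (.038, .019)`, HYPOTHESIS-FREE: string tension on the ball** — one `c > 0` such that
every infinite-volume limit state `μ` of every eventually-member family satisfies `HasAreaLawWith μ χ₃ C c` and, whenever its string tension exists,
`c ≤ suFundStringTension 3 μ`.  Input: `su3_pv2tRow4_29_50`. [folklore] -/
theorem su3_stringTension_onBall_pv2t_29_50 (r : ℕ) {mv : ℕ} (hmv : 1 ≤ mv) :
    ∃ C c : ℝ, 0 < c ∧ ∀ 𝓦 : PerturbationFamily 4 3,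
      (∀ᶠ L : ℕ in atTop, 𝓦 L ∈ ClusterDomainFR (2 * (19 / 1000)) (19 / 1000) r ∧ IsSlabLocal mv (𝓦 L)) →
        ∀ μ ∈ perturbedLimitPoints ((29 / 50 : ℝ) / 3) 𝓦,
          HasAreaLawWith μ (fun g => normalisedCharacter 3 (fundamentalRep (Fin 3) g)) C c ∧
          ((∃ σ : ℝ, HasStringTension μ (fun g => normalisedCharacter 3 (fundamentalRep (Fin 3) g)) σ) →
            c ≤ suFundStringTension 3 μ) :=
  suFundStringTension_ge_onBall (su3_pv2tRow4_29_50 r hmv)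

/-! ### Tier 2 (`ClusterDomain (log 6/5) (2ε) ε`) -/

/-- **`SU(3)`, `d = 4`, `β_W = 2/5`, TIER-2 ball `ClusterDomain (log 6/5) (.362) (.181)`, HYPOTHESIS-FREE**: the same reading, from
`su3_pv2tRowW4_2_5`. [folklore] -/
theorem su3_stringTension_onBallW_pv2t_2_5 {mv : ℕ} (hmv : 1 ≤ mv) :
    ∃ C c : ℝ, 0 < c ∧ ∀ 𝓦 : PerturbationFamily 4 3,
      (∀ᶠ L : ℕ in atTop, 𝓦 L ∈ ClusterDomain (Real.log (6 / 5)) (2 * (181 / 1000)) (181 / 1000) ∧ IsSlabLocal mv (𝓦 L)) →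
        ∀ μ ∈ perturbedLimitPoints ((2 / 5 : ℝ) / 3) 𝓦,
          HasAreaLawWith μ (fun g => normalisedCharacter 3 (fundamentalRep (Fin 3) g)) C c ∧
          ((∃ σ : ℝ, HasStringTension μ (fun g => normalisedCharacter 3 (fundamentalRep (Fin 3) g)) σ) →
            c ≤ suFundStringTension 3 μ) :=
  suFundStringTension_ge_onBallW (su3_pv2tRowW4_2_5 hmv)

/-- **`SU(3)`, `d = 4`, `β_W = 9/20`, TIER-2 ball `ClusterDomain (log 6/5) (.258) (.129)`, HYPOTHESIS-FREE**: the same reading, from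
`su3_pv2tRowW4_9_20`. [folklore] -/
theorem su3_stringTension_onBallW_pv2t_9_20 {mv : ℕ} (hmv : 1 ≤ mv) :
    ∃ C c : ℝ, 0 < c ∧ ∀ 𝓦 : PerturbationFamily 4 3,
      (∀ᶠ L : ℕ in atTop, 𝓦 L ∈ ClusterDomain (Real.log (6 / 5)) (2 * (129 / 1000)) (129 / 1000) ∧ IsSlabLocal mv (𝓦 L)) →
        ∀ μ ∈ perturbedLimitPoints ((9 / 20 : ℝ) / 3) 𝓦,
          HasAreaLawWith μ (fun g => normalisedCharacter 3 (fundamentalRep (Fin 3) g)) C c ∧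
          ((∃ σ : ℝ, HasStringTension μ (fun g => normalisedCharacter 3 (fundamentalRep (Fin 3) g)) σ) →
            c ≤ suFundStringTension 3 μ) :=
  suFundStringTension_ge_onBallW (su3_pv2tRowW4_9_20 hmv)

/-- **`SU(3)`, `d = 4`, `β_W = 1/2`, TIER-2 ball `ClusterDomain (log 6/5) (.158) (.079)`, HYPOTHESIS-FREE**: the same reading, from
`su3_pv2tRowW4_1_2`. [folklore] -/
theorem su3_stringTension_onBallW_pv2t_1_2 {mv : ℕ} (hmv : 1 ≤ mv) :
    ∃ C c : ℝ, 0 < c ∧ ∀ 𝓦 : PerturbationFamily 4 3,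
      (∀ᶠ L : ℕ in atTop, 𝓦 L ∈ ClusterDomain (Real.log (6 / 5)) (2 * (79 / 1000)) (79 / 1000) ∧ IsSlabLocal mv (𝓦 L)) →
        ∀ μ ∈ perturbedLimitPoints ((1 / 2 : ℝ) / 3) 𝓦,
          HasAreaLawWith μ (fun g => normalisedCharacter 3 (fundamentalRep (Fin 3) g)) C c ∧
          ((∃ σ : ℝ, HasStringTension μ (fun g => normalisedCharacter 3 (fundamentalRep (Fin 3) g)) σ) →
            c ≤ suFundStringTension 3 μ) :=
  suFundStringTension_ge_onBallW (su3_pv2tRowW4_1_2 hmv)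

/-- **`SU(3)`, `d = 4`, `β_W = 11/20`, TIER-2 ball `ClusterDomain (log 6/5) (.058) (.029)`, HYPOTHESIS-FREE**: the same reading, from
`su3_pv2tRowW4_11_20`. [folklore] -/
theorem su3_stringTension_onBallW_pv2t_11_20 {mv : ℕ} (hmv : 1 ≤ mv) :
    ∃ C c : ℝ, 0 < c ∧ ∀ 𝓦 : PerturbationFamily 4 3,
      (∀ᶠ L : ℕ in atTop, 𝓦 L ∈ ClusterDomain (Real.log (6 / 5)) (2 * (29 / 1000)) (29 / 1000) ∧ IsSlabLocal mv (𝓦 L)) →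
        ∀ μ ∈ perturbedLimitPoints ((11 / 20 : ℝ) / 3) 𝓦,
          HasAreaLawWith μ (fun g => normalisedCharacter 3 (fundamentalRep (Fin 3) g)) C c ∧
          ((∃ σ : ℝ, HasStringTension μ (fun g => normalisedCharacter 3 (fundamentalRep (Fin 3) g)) σ) →
            c ≤ suFundStringTension 3 μ) :=
  suFundStringTension_ge_onBallW (su3_pv2tRowW4_11_20 hmv)

/-- **`SU(3)`, `d = 4`, `β_W = 14/25`, TIER-2 ball `ClusterDomain (log 6/5) (.038) (.019)`, HYPOTHESIS-FREE**: the same reading, from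
`su3_pv2tRowW4_14_25`. [folklore] -/
theorem su3_stringTension_onBallW_pv2t_14_25 {mv : ℕ} (hmv : 1 ≤ mv) :
    ∃ C c : ℝ, 0 < c ∧ ∀ 𝓦 : PerturbationFamily 4 3,
      (∀ᶠ L : ℕ in atTop, 𝓦 L ∈ ClusterDomain (Real.log (6 / 5)) (2 * (19 / 1000)) (19 / 1000) ∧ IsSlabLocal mv (𝓦 L)) →
        ∀ μ ∈ perturbedLimitPoints ((14 / 25 : ℝ) / 3) 𝓦,
          HasAreaLawWith μ (fun g => normalisedCharacter 3 (fundamentalRep (Fin 3) g)) C c ∧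
          ((∃ σ : ℝ, HasStringTension μ (fun g => normalisedCharacter 3 (fundamentalRep (Fin 3) g)) σ) →
            c ≤ suFundStringTension 3 μ) :=
  suFundStringTension_ge_onBallW (su3_pv2tRowW4_14_25 hmv)

/-! ### The string-tension reading of the `d = 4` segment `0 ≤ β_W ≤ 1/2` -/

/-- **`SU(3)`, `d = 4`, HYPOTHESIS-FREE: string tension on the ball for the WHOLE SEGMENT `0 ≤ β_W ≤ 1/2`** on the fixed ball
`ClusterDomainFR (97/500) (97/1000) r` — rb-p2's `suFundStringTension_ge_onBall` on `su3_pv2tRow4_upTo_1_2`. [folklore] -/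
theorem su3_stringTension_onBall_pv2t_upTo_1_2 {βW : ℝ} (h0 : 0 ≤ βW) (h : βW ≤ 1 / 2) (r : ℕ) {mv : ℕ} (hmv : 1 ≤ mv) :
    ∃ C c : ℝ, 0 < c ∧ ∀ 𝓦 : PerturbationFamily 4 3,
      (∀ᶠ L : ℕ in atTop, 𝓦 L ∈ ClusterDomainFR (2 * (97 / 1000)) (97 / 1000) r ∧ IsSlabLocal mv (𝓦 L)) →
        ∀ μ ∈ perturbedLimitPoints (βW / 3) 𝓦,
          HasAreaLawWith μ (fun g => normalisedCharacter 3 (fundamentalRep (Fin 3) g)) C c ∧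
          ((∃ σ : ℝ, HasStringTension μ (fun g => normalisedCharacter 3 (fundamentalRep (Fin 3) g)) σ) →
            c ≤ suFundStringTension 3 μ) :=
  suFundStringTension_ge_onBall (su3_pv2tRow4_upTo_1_2 h0 h r hmv)

end Summit.Ventures.YMGap.RobustBallPV

end
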